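import Literature.Analysis.FluidPDE.AlbrittonBlowupCriterion
import HarnessLib

/-!
# Albritton's blow-up criterion in continuation form

Analysis/FluidPDE proof file (no definitions, no named facts) next to
`Literature.Analysis.FluidPDE.AlbrittonBlowupCriterion`. Albritton, *Blow-up criteria for the
Navier–Stokes equations in non-endpoint critical Besov spaces*, Anal. PDE 11 (2018) 1415–1456 =
arXiv:1612.04439, **Thm. 1.1**, is vendored as the named fact
`Literature.Analysis.FluidPDE.albritton_besov_blowup` (`CriticalRegularity.lean`): for a *maximal*
Besov mild solution (`IsMaximalBesovMildSolution`, lifespan `0 < T < ∞`, class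
`C([0,T); Ḃ^{-1+3/p}_{p,q}) ∩ K̊_∞`, `3 < p, q < ∞`) the critical norm `‖U t‖_{Ḃ^{-1+3/p}_{p,q}}`
tends to `∞` as `t ↑ T`. Since maximality is rendered there as *non-extendability in the class*
(`IsMaximalBesovMildSolution.not_extendable`), the theorem is equivalent to a **continuation
criterion** — the form in which blow-up criteria are used (Albritton 2018, Thm. 4.2 (i)–(ii),
"characterizations of the maximal time of existence"; §3, the contradiction hypothesis (3.2)
"there exists a sequence `t_n ↑ 1` and constant `M > 0` such that `‖u(·, t_n)‖ ≤ M`"): a Besov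
mild solution on `[0, T)` whose critical norm stays below some level `M` frequently as `t ↑ T`
(i.e. `liminf_{t ↑ T} ‖U t‖ < ∞`) extends, in the same class, to a longer interval `[0, T')`.
This file proves that equivalence (`albritton_besov_blowup_iff_continuation`) and the pointed
consequence `albritton_besov_blowup.exists_extension`. No statement of the tree is changed; no new
named fact is introduced; with `albritton_besov_blowup_of_albritton`
(`AlbrittonBlowupCriterionProofs.lean`) the continuation form follows from the two Albritton
statements `albritton_singular_point_of_blowup` (Cor. 4.6) and `albritton_regular_of_liminf_besov`
(§3, Steps 1–3).

## References

* D. Albritton, *Blow-up criteria for the Navier–Stokes equations in non-endpoint critical Besov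
  spaces*, Anal. PDE 11 (2018) 1415–1456 = arXiv:1612.04439, Thm. 1.1; Thm. 4.2 (i)–(ii); §3,
  hypothesis (3.2). [cite: Albritton2018, Thm. 1.1]
-/

noncomputable section

open MeasureTheory TemperedDistribution Set Function Filter Metric
open _root_.Topology
open scoped SchwartzMap ENNReal NNReal

namespace Literature.Analysis.FluidPDE

/-- **Albritton's Theorem 1.1 as a continuation criterion, pointed form.** Assume
`albritton_besov_blowup` (Albritton 2018, Thm. 1.1). Let `ν > 0`, `3 < p, q < ∞`, `0 < T`, and let
`(u, U)` be a Besov mild solution of the unforced Navier–Stokes equations on `ℝ³ × [0, T)` in the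
class `C([0,T); Ḃ^{-1+3/p}_{p,q}) ∩ K̊_∞` (`IsBesovMildSolutionOn`) whose critical norm is at most
`M` frequently as `t ↑ T` for some finite `M` (Albritton's hypothesis (3.2), §3:
`liminf_{t ↑ T} ‖U t‖_{Ḃ^{-1+3/p}_{p,q}} < ∞`). Then `T` is not the maximal time: there are
`T' > T` and a Besov mild solution `(v, V)` of the same class on `[0, T')` with `v t = u t` a.e.
for every `t ∈ [0, T)` (the negation of `IsMaximalBesovMildSolution.not_extendable`; Albritton
2018, Thm. 1.1 read through Thm. 4.2: "`T*(u₀) < ∞` implies `lim_{t ↑ T*} ‖u(t)‖ = ∞`", so a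
finite `liminf` at `T` forces `T < T*`). [cite: Albritton2018, Thm. 1.1] -/
theorem albritton_besov_blowup.exists_extension (h : albritton_besov_blowup) {ν : ℝ} (hν : 0 < ν)
    {p q : ℝ≥0∞} [Fact (1 ≤ p)] (hp₃ : 3 < p) (hp : p < ∞) (hq₃ : 3 < q) (hq : q < ∞) {T : ℝ}
    (hT : 0 < T) {u : ℝ → EuclideanSpace ℝ (Fin 3) → EuclideanSpace ℝ (Fin 3)}
    {U : ℝ → 𝓢'(EuclideanSpace ℝ (Fin 3), EuclideanSpace ℂ (Fin 3))}
    (hu : IsBesovMildSolutionOn (-1 + 3 / p.toReal) p q T ν u U)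
    (hM : ∃ M : ℝ≥0, ∃ᶠ t in 𝓝[<] T,
      FunctionSpaces.eHomBesovNorm (-1 + 3 / p.toReal) p q (U t) ≤ M) :
    ∃ T' > T, ∃ (v : ℝ → EuclideanSpace ℝ (Fin 3) → EuclideanSpace ℝ (Fin 3))
      (V : ℝ → 𝓢'(EuclideanSpace ℝ (Fin 3), EuclideanSpace ℂ (Fin 3))),
      IsBesovMildSolutionOn (-1 + 3 / p.toReal) p q T' ν v V ∧ ∀ t ∈ Ico 0 T, v t =ᵐ[volume] u t := by
  by_contra hne
  obtain ⟨M, hM⟩ := hM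
  exact h.not_frequently_le hν hp₃ hp hq₃ hq hT ⟨hu, hne⟩ M hM

/-- **Albritton's Theorem 1.1 ⇔ the continuation criterion.** The named fact
`albritton_besov_blowup` (Albritton 2018, Thm. 1.1: at a finite maximal time the critical Besov
norm of a Besov mild solution tends to `∞`) is *equivalent* to: every Besov mild solution on
`[0, T)`, `0 < T`, of the class `C([0,T); Ḃ^{-1+3/p}_{p,q}) ∩ K̊_∞`, `3 < p, q < ∞`, `ν > 0`, with
`liminf_{t ↑ T} ‖U t‖_{Ḃ^{-1+3/p}_{p,q}} < ∞` (some level `M` undershot frequently as `t ↑ T`,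
Albritton's (3.2)) extends in the class past `T`. Forward: `albritton_besov_blowup.exists_extension`.
Backward: if the norm does not tend to `∞` at a maximal time, some finite level is undershot
frequently (`not_tendsto_nhds_top_iff_exists_frequently_le`), so the solution extends — against
`IsMaximalBesovMildSolution.not_extendable`. (Albritton 2018, Thm. 1.1 with Thm. 4.2, the
characterisation of `T*(u₀)` as the maximal time of existence in the class.)
[cite: Albritton2018, Thm. 1.1] -/
theorem albritton_besov_blowup_iff_continuation :
    albritton_besov_blowup ↔
      ∀ {ν : ℝ} (_ : 0 < ν) {p q : ℝ≥0∞} [Fact (1 ≤ p)] (_ : 3 < p) (_ : p < ∞) (_ : 3 < q)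
        (_ : q < ∞) {T : ℝ} (_ : 0 < T)
        {u : ℝ → EuclideanSpace ℝ (Fin 3) → EuclideanSpace ℝ (Fin 3)}
        {U : ℝ → 𝓢'(EuclideanSpace ℝ (Fin 3), EuclideanSpace ℂ (Fin 3))}
        (_ : IsBesovMildSolutionOn (-1 + 3 / p.toReal) p q T ν u U)
        (_ : ∃ M : ℝ≥0, ∃ᶠ t in 𝓝[<] T,
          FunctionSpaces.eHomBesovNorm (-1 + 3 / p.toReal) p q (U t) ≤ M),
        ∃ T' > T, ∃ (v : ℝ → EuclideanSpace ℝ (Fin 3) → EuclideanSpace ℝ (Fin 3))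
          (V : ℝ → 𝓢'(EuclideanSpace ℝ (Fin 3), EuclideanSpace ℂ (Fin 3))),
          IsBesovMildSolutionOn (-1 + 3 / p.toReal) p q T' ν v V ∧
            ∀ t ∈ Ico 0 T, v t =ᵐ[volume] u t := by
  constructor
  · intro h ν hν p q _ hp₃ hp hq₃ hq T hT u U hu hM
    exact h.exists_extension hν hp₃ hp hq₃ hq hT hu hM
  · intro h ν hν p q _ hp₃ hp hq₃ hq T hT u U hmax
    by_contra hnot
    obtain ⟨M, hM⟩ := not_tendsto_nhds_top_iff_exists_frequently_le.1 hnot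
    exact hmax.not_extendable (h hν hp₃ hp hq₃ hq hT hmax.isBesovMildSolutionOn ⟨M, hM⟩)

end Literature.Analysis.FluidPDE

end
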